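import Summits.Ventures.LatticeQCDFlow.Scaling.DominatedStarTagMarginal

/-!
HONEST FRAMING: exact (Metropolis-corrected) sampling algorithms for lattice gauge theory; figures
of merit are autocorrelation/cost numbers at stated couplings and volumes; no continuum-physics
claim.

# DominatedStarMinorization — THE LAW OF THE DOMINATED STAR ON THE EMPTY STALE SET IS `P(D_n = ∅)·π̃`, HENCE
# `(δ_x Pⁿ)(z) ≥ P(D_n = ∅)·π̃(z)` AND `‖δ_x Pⁿ − π̃‖_TV ≤ P(D_n ≠ ∅)` FOR THE MAP-ASSISTED HOT-REFRESHED HUB WITH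
# IMPERFECT TRANSPORTS UNDER ONE-SIDED DOMINATION (lean-2 GEN-25, ours)

Venture-side (OURS).  Cell `lqcd-flow` (pub-lqcd), unit `pub-lqcd-lean-2-g25`, 2026-08-27.  Chapter M (the
coupon-collector ceiling without perfect transports), file 8.  Setting of `Scaling/DominatedStarTagMarginal`.

## What is proved

* **`dom_lawAt_empty_eq`** — `λ̂_n(z, ∅) = (δ_{univ}Qⁿ)(∅)·π̃(z)` (fresh-exchangeability + `fresh_empty_proportional_prod`
  + the tag marginal); **`dom_minorization`** — `(δ_x Pⁿ)(z) ≥ (δ_{univ}Qⁿ)(∅)·π̃(z)` (here the two one-sided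
  dominations enter, through `0 ≤ γ_r ≤ α_r`, i.e. the non-negativity of the augmented kernel);
  **`dom_tvDist_le_stale`** — `‖δ_x Pⁿ − π̃‖_TV ≤ (δ_{univ}Qⁿ){D ≠ ∅}`.

Reading (no numerics implied): the distance to equilibrium of the real map-assisted hub from any cold start is at
most the probability that the conservative stale set is non-empty; `Scaling/RegenerationTagDecay` bounds that
probability and the sequel (`Scaling/DominatedStarMixingCeiling`) states the ceilings for the scheme itself.
Literature grade (cell rule): OWN CONSTRUCTION (a whole-space Doeblin minorisation from a genealogical coupling,
typed as linear invariants); nothing cited as a fact; no new bib keys.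
-/

noncomputable section

open Finset Function
open Literature.Probability.MarkovChains

namespace Summit.Ventures.LatticeQCDFlow.Scaling

variable {S : Type*} [Fintype S] [DecidableEq S] {K m : ℕ} {μ : Fin (K + 1) → S → ℝ} {M : Fin (K + 1) → S → S → ℝ}
  {w : Fin (K + 1) → ℝ} {t p q : ℝ}

section Minor
variable (κ : Fin m → Fin K) (φ : Fin m → Equiv.Perm S)

/-! ## §1 The empty tag and the minorisation -/

/-- **`λ̂_n(z, ∅) = (δ_{univ}Qⁿ)(∅)·π̃(z)`:** on the empty stale set the augmented law is the equilibrium `π̃ = ⊗μ_k` times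
the probability that the stale set is empty. [ours] -/
theorem dom_lawAt_empty_eq (hμ : ∀ k x, 0 < μ k x) (hμ1 : ∀ k, ∑ u, μ k u = 1) (hM : ∀ k, IsRowStochastic (M k))
    (hM0 : ∀ u v, M 0 u v = μ 0 v) (hstat : ∀ k : Fin (K + 1), k ≠ 0 → ∀ v, ∑ u, μ k u * M k u v = μ k v)
    (hw1 : ∑ k, w k = 1)
    {α : Fin m → (Fin (K + 1) → S) → ℝ}
    (hα : ∀ r z, α r z = min 1 (tensorFun μ (edgeFlowSwap (φ r) 0 (κ r).succ z) / tensorFun μ z))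
    {β : Fin m → (Fin (K + 1) → S) → ℝ} (hβ : ∀ r z, β r z = p * μ (κ r).succ (φ r (z 0)) / μ 0 (z 0))
    {β' : Fin m → (Fin (K + 1) → S) → ℝ}
    (hβ' : ∀ r z, β' r z = q * μ 0 ((φ r).symm (z (κ r).succ)) / μ (κ r).succ (z (κ r).succ))
    {γ : Fin m → (Fin (K + 1) → S) × Finset (Fin (K + 1)) → ℝ}
    (hγ : ∀ r a, γ r a = if (0 : Fin (K + 1)) ∉ a.2 then (if (κ r).succ ∉ a.2 then α r a.1 else β r a.1)
      else (if (κ r).succ ∉ a.2 then β' r a.1 else 0))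
    {gbar : Fin m → Finset (Fin (K + 1)) → ℝ}
    (hg : ∀ r D, gbar r D = if (0 : Fin (K + 1)) ∉ D then (if (κ r).succ ∉ D then (1 : ℝ) else p)
      else (if (κ r).succ ∉ D then q else 0))
    {Bset : Fin m → Finset (Fin (K + 1)) → Finset (Fin (K + 1))}
    (hB : ∀ r D, Bset r D = if (0 : Fin (K + 1)) ∉ D ∧ (κ r).succ ∉ D then D
      else insert (0 : Fin (K + 1)) (insert (κ r).succ D))
    {Ph : (Fin (K + 1) → S) × Finset (Fin (K + 1)) → (Fin (K + 1) → S) × Finset (Fin (K + 1)) → ℝ}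
    (hPh : ∀ a b, Ph a b = ∑ r : Fin m, t / m *
        (γ r a * (if b.1 = edgeFlowSwap (φ r) 0 (κ r).succ a.1 ∧ b.2 = a.2.image (Equiv.swap (0 : Fin (K + 1)) (κ r).succ)
            then (1 : ℝ) else 0)
          + (α r a.1 - γ r a) * (if b.1 = edgeFlowSwap (φ r) 0 (κ r).succ a.1 ∧ b.2 = Bset r a.2 then (1 : ℝ) else 0)
          + (1 - α r a.1) * (if b.1 = a.1 ∧ b.2 = Bset r a.2 then (1 : ℝ) else 0))
      + (1 - t) * ∑ k : Fin (K + 1), w k * (coordKernel M k a.1 b.1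
          * (if b.2 = (if k = 0 then a.2.erase 0 else a.2) then (1 : ℝ) else 0)))
    {Q : Finset (Fin (K + 1)) → Finset (Fin (K + 1)) → ℝ}
    (hQ : ∀ D D', Q D D' = ∑ r : Fin m, t / m *
        (gbar r D * (if D' = D.image (Equiv.swap (0 : Fin (K + 1)) (κ r).succ) then (1 : ℝ) else 0)
          + (1 - gbar r D) * (if D' = Bset r D then (1 : ℝ) else 0))
      + (1 - t) * (w 0 * (if D' = D.erase 0 then (1 : ℝ) else 0) + (1 - w 0) * (if D' = D then (1 : ℝ) else 0)))
    (x : Fin (K + 1) → S) (n : ℕ) (z : Fin (K + 1) → S) :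
    lawAt Ph (Pi.single (x, (univ : Finset (Fin (K + 1)))) 1) n (z, ∅)
      = lawAt Q (Pi.single (univ : Finset (Fin (K + 1))) 1) n ∅ * tensorFun μ z := by
  have hprop := fresh_empty_proportional_prod hμ (dom_fresh_lawAt κ φ hμ hM0 hstat hα hβ hβ' hγ hB hPh x n)
  have hπ1 : ∑ z', tensorFun μ z' = 1 := sum_tensorFun_eq_one _ hμ1
  have hsum : lawAt Ph (Pi.single (x, (univ : Finset (Fin (K + 1)))) 1) n (z, ∅) * ∑ z', tensorFun μ z'
      = (∑ z', lawAt Ph (Pi.single (x, (univ : Finset (Fin (K + 1)))) 1) n (z', ∅)) * tensorFun μ z := by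
    rw [Finset.mul_sum, Finset.sum_mul]
    exact sum_congr rfl fun z' _ => hprop z z'
  rw [hπ1, mul_one, dom_lawAt_snd κ φ hμ hμ1 hM hM0 hstat hw1 hα hβ hβ' hγ hg hB hPh hQ x n ∅] at hsum
  exact hsum

/-- **MINORISATION: `(δ_x Pⁿ)(z) ≥ (δ_{univ}Qⁿ)(∅)·π̃(z)`** for the map-assisted hot-refreshed hub under the two
one-sided dominations (`p·μ_l(φ_r u) ≤ μ_0(u)`, `q·μ_0(u) ≤ μ_l(φ_r u)`, `0 ≤ p, q`), every start `x`. [ours] -/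
theorem dom_minorization (hm : 1 ≤ m) (ht0 : 0 ≤ t) (ht1 : t ≤ 1) (hw0 : ∀ k, 0 ≤ w k) (hw1 : ∑ k, w k = 1)
    (hμ : ∀ k x, 0 < μ k x) (hμ1 : ∀ k, ∑ u, μ k u = 1) (hM : ∀ k, IsRowStochastic (M k))
    (hM0 : ∀ u v, M 0 u v = μ 0 v) (hstat : ∀ k : Fin (K + 1), k ≠ 0 → ∀ v, ∑ u, μ k u * M k u v = μ k v)
    (hp0 : 0 ≤ p) (hq0 : 0 ≤ q) (hdom : ∀ r u, p * μ (κ r).succ (φ r u) ≤ μ 0 u)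
    (hrev : ∀ r u, q * μ 0 u ≤ μ (κ r).succ (φ r u))
    {α : Fin m → (Fin (K + 1) → S) → ℝ}
    (hα : ∀ r z, α r z = min 1 (tensorFun μ (edgeFlowSwap (φ r) 0 (κ r).succ z) / tensorFun μ z))
    {β : Fin m → (Fin (K + 1) → S) → ℝ} (hβ : ∀ r z, β r z = p * μ (κ r).succ (φ r (z 0)) / μ 0 (z 0))
    {β' : Fin m → (Fin (K + 1) → S) → ℝ}
    (hβ' : ∀ r z, β' r z = q * μ 0 ((φ r).symm (z (κ r).succ)) / μ (κ r).succ (z (κ r).succ))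
    {γ : Fin m → (Fin (K + 1) → S) × Finset (Fin (K + 1)) → ℝ}
    (hγ : ∀ r a, γ r a = if (0 : Fin (K + 1)) ∉ a.2 then (if (κ r).succ ∉ a.2 then α r a.1 else β r a.1)
      else (if (κ r).succ ∉ a.2 then β' r a.1 else 0))
    {gbar : Fin m → Finset (Fin (K + 1)) → ℝ}
    (hg : ∀ r D, gbar r D = if (0 : Fin (K + 1)) ∉ D then (if (κ r).succ ∉ D then (1 : ℝ) else p)
      else (if (κ r).succ ∉ D then q else 0))
    {Bset : Fin m → Finset (Fin (K + 1)) → Finset (Fin (K + 1))}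
    (hB : ∀ r D, Bset r D = if (0 : Fin (K + 1)) ∉ D ∧ (κ r).succ ∉ D then D
      else insert (0 : Fin (K + 1)) (insert (κ r).succ D))
    {Ph : (Fin (K + 1) → S) × Finset (Fin (K + 1)) → (Fin (K + 1) → S) × Finset (Fin (K + 1)) → ℝ}
    (hPh : ∀ a b, Ph a b = ∑ r : Fin m, t / m *
        (γ r a * (if b.1 = edgeFlowSwap (φ r) 0 (κ r).succ a.1 ∧ b.2 = a.2.image (Equiv.swap (0 : Fin (K + 1)) (κ r).succ)
            then (1 : ℝ) else 0)
          + (α r a.1 - γ r a) * (if b.1 = edgeFlowSwap (φ r) 0 (κ r).succ a.1 ∧ b.2 = Bset r a.2 then (1 : ℝ) else 0)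
          + (1 - α r a.1) * (if b.1 = a.1 ∧ b.2 = Bset r a.2 then (1 : ℝ) else 0))
      + (1 - t) * ∑ k : Fin (K + 1), w k * (coordKernel M k a.1 b.1
          * (if b.2 = (if k = 0 then a.2.erase 0 else a.2) then (1 : ℝ) else 0)))
    {Q : Finset (Fin (K + 1)) → Finset (Fin (K + 1)) → ℝ}
    (hQ : ∀ D D', Q D D' = ∑ r : Fin m, t / m *
        (gbar r D * (if D' = D.image (Equiv.swap (0 : Fin (K + 1)) (κ r).succ) then (1 : ℝ) else 0)
          + (1 - gbar r D) * (if D' = Bset r D then (1 : ℝ) else 0))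
      + (1 - t) * (w 0 * (if D' = D.erase 0 then (1 : ℝ) else 0) + (1 - w 0) * (if D' = D then (1 : ℝ) else 0)))
    (x : Fin (K + 1) → S) (n : ℕ) (z : Fin (K + 1) → S) :
    lawAt Q (Pi.single (univ : Finset (Fin (K + 1))) 1) n ∅ * tensorFun μ z
      ≤ lawAt (fun y z : Fin (K + 1) → S =>
          t * ptGraphSwap μ (fun r : Fin m => (((0 : Fin (K + 1)), (κ r).succ) : Fin (K + 1) × Fin (K + 1))) φ y z
          + (1 - t) * prodKernel w M y z) (Pi.single x 1) n z := by
  rw [← dom_lawAt_fst κ φ hm hμ hα hPh x n z,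
    ← dom_lawAt_empty_eq κ φ hμ hμ1 hM hM0 hstat hw1 hα hβ hβ' hγ hg hB hPh hQ x n z]
  have hγα := goodWeight_le_accept κ φ hμ hp0 hq0 hα hβ hβ' hγ hdom hrev
  have hnn : ∀ b, 0 ≤ lawAt Ph (Pi.single (x, (univ : Finset (Fin (K + 1)))) 1) n b := fun b =>
    lawAt_nonneg (dom_aug_isRowStochastic κ φ hm ht0 ht1 hw0 hw1 hM hμ hα hγα hPh) (fun a => by
      by_cases h : a = (x, (univ : Finset (Fin (K + 1))))
      · subst h; rw [Pi.single_eq_same]; norm_num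
      · rw [Pi.single_eq_of_ne h]) n b
  exact Finset.single_le_sum (f := fun D => lawAt Ph (Pi.single (x, (univ : Finset (Fin (K + 1)))) 1) n (z, D))
    (fun D _ => hnn (z, D)) (mem_univ ∅)

/-- **THE FRESHNESS BOUND WITH IMPERFECT TRANSPORTS: `‖δ_x Pⁿ − π̃‖_TV ≤ (δ_{univ}Qⁿ){D ≠ ∅}`** for the map-assisted
hot-refreshed hub under the two one-sided dominations (`0 ≤ p, q ≤ 1`), from every start. [ours] -/
theorem dom_tvDist_le_stale (hm : 1 ≤ m) (ht0 : 0 ≤ t) (ht1 : t ≤ 1) (hw0 : ∀ k, 0 ≤ w k) (hw1 : ∑ k, w k = 1)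
    (hμ : ∀ k x, 0 < μ k x) (hμ1 : ∀ k, ∑ u, μ k u = 1) (hM : ∀ k, IsRowStochastic (M k))
    (hM0 : ∀ u v, M 0 u v = μ 0 v) (hstat : ∀ k : Fin (K + 1), k ≠ 0 → ∀ v, ∑ u, μ k u * M k u v = μ k v)
    (hp0 : 0 ≤ p) (hp1 : p ≤ 1) (hq0 : 0 ≤ q) (hq1 : q ≤ 1) (hdom : ∀ r u, p * μ (κ r).succ (φ r u) ≤ μ 0 u)
    (hrev : ∀ r u, q * μ 0 u ≤ μ (κ r).succ (φ r u))
    {α : Fin m → (Fin (K + 1) → S) → ℝ}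
    (hα : ∀ r z, α r z = min 1 (tensorFun μ (edgeFlowSwap (φ r) 0 (κ r).succ z) / tensorFun μ z))
    {β : Fin m → (Fin (K + 1) → S) → ℝ} (hβ : ∀ r z, β r z = p * μ (κ r).succ (φ r (z 0)) / μ 0 (z 0))
    {β' : Fin m → (Fin (K + 1) → S) → ℝ}
    (hβ' : ∀ r z, β' r z = q * μ 0 ((φ r).symm (z (κ r).succ)) / μ (κ r).succ (z (κ r).succ))
    {γ : Fin m → (Fin (K + 1) → S) × Finset (Fin (K + 1)) → ℝ}
    (hγ : ∀ r a, γ r a = if (0 : Fin (K + 1)) ∉ a.2 then (if (κ r).succ ∉ a.2 then α r a.1 else β r a.1)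
      else (if (κ r).succ ∉ a.2 then β' r a.1 else 0))
    {gbar : Fin m → Finset (Fin (K + 1)) → ℝ}
    (hg : ∀ r D, gbar r D = if (0 : Fin (K + 1)) ∉ D then (if (κ r).succ ∉ D then (1 : ℝ) else p)
      else (if (κ r).succ ∉ D then q else 0))
    {Bset : Fin m → Finset (Fin (K + 1)) → Finset (Fin (K + 1))}
    (hB : ∀ r D, Bset r D = if (0 : Fin (K + 1)) ∉ D ∧ (κ r).succ ∉ D then D
      else insert (0 : Fin (K + 1)) (insert (κ r).succ D))
    {Ph : (Fin (K + 1) → S) × Finset (Fin (K + 1)) → (Fin (K + 1) → S) × Finset (Fin (K + 1)) → ℝ}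
    (hPh : ∀ a b, Ph a b = ∑ r : Fin m, t / m *
        (γ r a * (if b.1 = edgeFlowSwap (φ r) 0 (κ r).succ a.1 ∧ b.2 = a.2.image (Equiv.swap (0 : Fin (K + 1)) (κ r).succ)
            then (1 : ℝ) else 0)
          + (α r a.1 - γ r a) * (if b.1 = edgeFlowSwap (φ r) 0 (κ r).succ a.1 ∧ b.2 = Bset r a.2 then (1 : ℝ) else 0)
          + (1 - α r a.1) * (if b.1 = a.1 ∧ b.2 = Bset r a.2 then (1 : ℝ) else 0))
      + (1 - t) * ∑ k : Fin (K + 1), w k * (coordKernel M k a.1 b.1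
          * (if b.2 = (if k = 0 then a.2.erase 0 else a.2) then (1 : ℝ) else 0)))
    {Q : Finset (Fin (K + 1)) → Finset (Fin (K + 1)) → ℝ}
    (hQ : ∀ D D', Q D D' = ∑ r : Fin m, t / m *
        (gbar r D * (if D' = D.image (Equiv.swap (0 : Fin (K + 1)) (κ r).succ) then (1 : ℝ) else 0)
          + (1 - gbar r D) * (if D' = Bset r D then (1 : ℝ) else 0))
      + (1 - t) * (w 0 * (if D' = D.erase 0 then (1 : ℝ) else 0) + (1 - w 0) * (if D' = D then (1 : ℝ) else 0)))
    (x : Fin (K + 1) → S) (n : ℕ) :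
    tvDist (lawAt (fun y z : Fin (K + 1) → S =>
          t * ptGraphSwap μ (fun r : Fin m => (((0 : Fin (K + 1)), (κ r).succ) : Fin (K + 1) × Fin (K + 1))) φ y z
          + (1 - t) * prodKernel w M y z) (Pi.single x 1) n) (tensorFun μ)
      ≤ ∑ D ∈ univ.filter (fun D : Finset (Fin (K + 1)) => D ≠ ∅), lawAt Q (Pi.single (univ : Finset (Fin (K + 1))) 1) n D := by
  have hP := weightedScheme_isRowStochastic (t := t) (w := w)
    (ptGraphSwap_isRowStochastic (e := fun r : Fin m => (((0 : Fin (K + 1)), (κ r).succ) : Fin (K + 1) × Fin (K + 1)))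
      (φ := φ) hμ) hM hw0 hw1 ht0 ht1
  have hw00 : 0 ≤ w 0 := hw0 0
  have hw01 : w 0 ≤ 1 := by
    have h := Finset.single_le_sum (f := w) (fun k _ => hw0 k) (mem_univ (0 : Fin (K + 1)))
    rw [hw1] at h; exact h
  have hQst := regen_isRowStochastic κ hm ht0 ht1 hw00 hw01 hp0 hp1 hq0 hq1 hg hQ
  have hmassQ : ∑ D, lawAt Q (Pi.single (univ : Finset (Fin (K + 1))) 1) n D = 1 := by
    rw [sum_lawAt hQst, Finset.sum_pi_single', if_pos (mem_univ _)]
  have hsplit := Finset.sum_filter_add_sum_filter_not univ (fun D : Finset (Fin (K + 1)) => D ≠ ∅)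
    (fun D => lawAt Q (Pi.single (univ : Finset (Fin (K + 1))) 1) n D)
  have hE : univ.filter (fun D : Finset (Fin (K + 1)) => ¬D ≠ ∅) = {∅} := by
    ext D; simp only [Finset.mem_filter, Finset.mem_univ, true_and, not_not, Finset.mem_singleton]
  rw [hmassQ, hE, Finset.sum_singleton] at hsplit
  have htv := tvDist_le_of_pointwise_ge (fun z => (tensorFun_pos hμ z).le) (sum_tensorFun_eq_one _ hμ1)
    (by rw [sum_lawAt hP, Finset.sum_pi_single', if_pos (mem_univ _)])
    (fun z => dom_minorization κ φ hm ht0 ht1 hw0 hw1 hμ hμ1 hM hM0 hstat hp0 hq0 hdom hrev hα hβ hβ' hγ hg hB hPh hQ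
      x n z)
  linarith

end Minor

end Summit.Ventures.LatticeQCDFlow.Scaling

end
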